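import Literature.Barriers.NavierStokesRegularity.NavierStokesInequalityParamCalculus
import Literature.Barriers.NavierStokesRegularity.NavierStokesInequalityDampedProfile
import Literature.Barriers.NavierStokesRegularity.NavierStokesInequalityPressureSymmetry
import HarnessLib

/-!
# Perturbed profiles agreeing with `√(f² - 2tδφ)` off `{φ = 1}` are structures (Ożański 2017, (4.15), (4.20))

Barrier catalogue support file for `NavierStokesRegularity` (D-0021), on the discharge path of
fact D-II `Literature.Barriers.NavierStokesRegularity.NSIProfiles_of_arrangement`
(`NavierStokesInequalityProfiles`; W. S. Ożański, arXiv:1709.00602v4, §4.1). The sibling file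
`NavierStokesInequalityDampedProfile` treats the damped profile `h_t = √(f² - 2tδφ)` itself
(`dampedProfile f φ δ t`; Lemma 4.1 for `h_{1,t}`, (4.13)–(4.15)) and proves
`IsNSIStructure.exists_isNSIStructure_dampedProfile`: `(a v, h_t, ψ)` is a structure for
`t ∈ [0,T]`. The later profiles of §4.1 are NOT damped profiles: `h_{2,t}` ((4.14), with the
interaction integral `∫₀ᵗ v₂·F[v₁,h_{1,s}] ds`) and `qᵏ_{i,t}` ((4.16), with the oscillatory
integrals) differ from `√(fᵢ² - 2tδφᵢ)` on `{φᵢ = 1} ⊇ supp vᵢ` — but ONLY there, since `vᵢ = 0`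
on `{φᵢ < 1}` kills those integrals. This file therefore GENERALISES the sibling's structure
theorem (it is not a parallel proof: the damped-profile facts — gap, `h_t = f` off `supp φ`,
`h_t = 0` off `Ū`, `|a w|² ≤ |w|²` — are imported from it) to the form the sequel consumes:

* `IsNSIStructure.exists_perturbed_structure` — for a structure `(v,f,φ)` on `U` and `T > 0`
  there are `δ₀ > 0` and a cut-off `ψ ∈ C_c^∞(U;[0,1])`, `ψ = 1` on `{φ ≥ 1/4}`, such that for
  every `δ ∈ [0,δ₀]`, every `t ∈ [-1, T+1]` (BOTH signs of the perturbation `2tδ`: the profiles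
  of §4.1 live on an open interval around `[0,T]`), every smooth `g ≥ 0` which equals
  `√(f² - 2tδφ)` on `{φ < 1}` and satisfies `g > |v|` on `{φ = 1}` (an arbitrary smooth
  modification on `{φ = 1}` — covering `h_{2,t}` and `qᵏ_{i,t}`, (4.15), (4.20)):
  **`(bv, g, ψ)` is a structure on `U` for all `|b| ≤ 1`**, **`Lg ≥ 0` on `{φ < 1/4}`** (`> 0`
  on `supp φ ∩ {φ ≤ 1/4}`, `= Lf ≥ 0` off `supp φ`; the sign used in §4.2, Case 1), `g > 0` on
  `U`, `g = 0` off `Ū`, `g = f` off `supp φ`;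
* `IsNSIStructure.exists_opL_dampedProfile_gt` — the `L`-margin `L(√(f² - 2tδφ)) > c > 0` on
  `supp φ ∩ {φ ≤ 1/4}` for `δ ∈ [0,δ₀]` and `t ∈ [-1,T+1]` (two-sided in time; the sibling's
  `exists_opL_dampedProfile_ge` has `t ∈ [0,T]`), by the compactness step
  `exists_forall_opL_gt_of_compact` of `NavierStokesInequalityParamCalculus` applied to the
  two-sided family `(ε,q) ↦ √(f(q)² - εφ(q))`.

The cut-off is the sibling's steepened cut-off `ψ = smoothTransition(8φ - 1)`
(`steepCutoff_props` with `θ = 1/4`).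

## References

* W. S. Ożański, *On weak solutions to the Navier–Stokes inequality with internal
  singularities*, arXiv:1709.00602v4, Definition 3.3, Lemma 4.1 and its proof, (4.13)–(4.16),
  (4.20), §4.2 Case 1. [`Ozanski2017NSISingular`]
* V. Scheffer, *A solution to the Navier–Stokes inequality with an internal singularity*,
  Comm. Math. Phys. 101 (1985), Lemma 3.1 ((3.8)–(3.15)) and Lemma 3.2 ((3.34)–(3.41)).
  [`Scheffer1985`]
-/

noncomputable section

open Set Function Filter Topology Metric
open scoped ContDiff

namespace Literature.Barriers.NavierStokesRegularity

open Literature.Analysis.FluidPDE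

/-! ### The two-sided family `(ε, q) ↦ √(f² - εφ)` -/

/-- **Joint smoothness of `(ε, q) ↦ √(f(q)² - εφ(q))` where the radicand is positive**, for
smooth `f, φ` (`dampedProfile f φ δ t` is the slice `ε = 2tδ`). [folklore] -/
theorem contDiffOn_sqrt_sq_sub_family {f φ : ℝ × ℝ → ℝ} (hf : ContDiff ℝ ∞ f) (hφ : ContDiff ℝ ∞ φ) :
    ContDiffOn ℝ ∞ (uncurry fun (ε : ℝ) (q : ℝ × ℝ) => Real.sqrt (f q ^ 2 - ε * φ q))
      {p : ℝ × (ℝ × ℝ) | 0 < f p.2 ^ 2 - p.1 * φ p.2} := by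
  have hR : ContDiff ℝ ∞ fun p : ℝ × (ℝ × ℝ) => f p.2 ^ 2 - p.1 * φ p.2 :=
    ((hf.comp contDiff_snd).pow 2).sub (contDiff_fst.mul (hφ.comp contDiff_snd))
  intro p hp
  exact (hR.contDiffAt.sqrt (ne_of_gt hp)).contDiffWithinAt

/-- The set where the radicand is positive is open. [folklore] -/
theorem isOpen_setOf_radicand_pos {f φ : ℝ × ℝ → ℝ} (hf : Continuous f) (hφ : Continuous φ) :
    IsOpen {p : ℝ × (ℝ × ℝ) | 0 < f p.2 ^ 2 - p.1 * φ p.2} :=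
  isOpen_lt continuous_const
    (((hf.comp continuous_snd).pow 2).sub (continuous_fst.mul (hφ.comp continuous_snd)))

/-- `L 0 = 0`. [folklore] -/
theorem opL_zero (q : ℝ × ℝ) : opL (fun _ : ℝ × ℝ => (0 : ℝ)) q = 0 := by
  have h1 : derivR (fun _ : ℝ × ℝ => (0 : ℝ)) = fun _ => 0 := by
    funext q'; simp [derivR]
  have h2 : derivZ (fun _ : ℝ × ℝ => (0 : ℝ)) = fun _ => 0 := by
    funext q'; simp [derivZ]
  simp [opL, h1, h2]

/-- `{φ = 1} ⊆ supp φ`. [folklore] -/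
theorem mem_tsupport_of_eq_one {φ : ℝ × ℝ → ℝ} {q : ℝ × ℝ} (hq : φ q = 1) : q ∈ tsupport φ :=
  subset_tsupport _ (by rw [mem_support, hq]; exact one_ne_zero)

namespace IsNSIStructure

variable {U : Set (ℝ × ℝ)} {v : ℝ × ℝ → ℝ × ℝ} {f φ : ℝ × ℝ → ℝ}

/-- `{φ ≥ 1/4}` is a compact subset of `U` (closed, inside `supp φ`). [folklore] -/
theorem isCompact_setOf_le_φ (h : IsNSIStructure U v f φ) : IsCompact {q | 1 / 4 ≤ φ q} := by
  refine h.isCompact_tsupport_φ.of_isClosed_subset (isClosed_le continuous_const h.φ_smooth.continuous)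
    fun q hq => subset_tsupport _ ?_
  rw [mem_support]
  intro h0
  simp only [mem_setOf_eq, h0] at hq
  norm_num at hq

/-- `{φ ≥ 1/4} ⊆ U`. [folklore] -/
theorem setOf_le_φ_subset (h : IsNSIStructure U v f φ) : {q | 1 / 4 ≤ φ q} ⊆ U := by
  intro q hq
  refine h.tsupport_φ (subset_tsupport _ ?_)
  rw [mem_support]
  intro h0
  simp only [mem_setOf_eq, h0] at hq
  norm_num at hq

/-- The radicand `f² - 2tδφ` is positive on `U` whenever the gap holds on `supp φ`
(`f > 0` off `supp φ`). [cite: Ozanski2017NSISingular, Lemma 4.1 (proof)] -/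
theorem radicand_pos_of_gap (h : IsNSIStructure U v f φ) {m t δ : ℝ} (hm : 0 < m)
    (hgap : ∀ q ∈ tsupport φ, (v q).1 ^ 2 + (v q).2 ^ 2 + m ≤ f q ^ 2 - 2 * t * δ * φ q)
    {q : ℝ × ℝ} (hq : q ∈ U) : 0 < f q ^ 2 - 2 * t * δ * φ q := by
  by_cases hφ : q ∈ tsupport φ
  · have := hgap q hφ
    nlinarith [sq_nonneg (v q).1, sq_nonneg (v q).2]
  · rw [image_eq_zero_of_notMem_tsupport hφ, mul_zero, sub_zero]
    exact pow_pos (h.f_pos hq) 2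

/-- **`L(√(f² - 2tδφ)) > c > 0` on `supp φ ∩ {φ ≤ 1/4}` for `δ ∈ [0,δ₀]`, `t ∈ [-1,T+1]`**
(two-sided in time): at `ε = 2tδ = 0` this is `Lf ≥ c₀ > 0` (`exists_opL_ge_of_lt_one`),
and positivity persists for `|ε|` small by `exists_forall_opL_gt_of_compact`.
[cite: Ozanski2017NSISingular, Lemma 4.1 (proof) and Definition 3.3] [cite: Scheffer1985, Lemma 3.1 (3.15)] -/
theorem exists_opL_dampedProfile_gt (h : IsNSIStructure U v f φ) {T : ℝ} (hT : 0 < T) :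
    ∃ c > 0, ∃ δ₀ > 0, ∀ δ ∈ Icc (0 : ℝ) δ₀, ∀ t ∈ Icc (-1 : ℝ) (T + 1), ∀ q ∈ tsupport φ,
      φ q ≤ 1 / 4 → c < opL (dampedProfile f φ δ t) q := by
  obtain ⟨c₀, hc₀, hL⟩ := h.exists_opL_ge_of_lt_one (θ := 1 / 4) (by norm_num)
  set K : Set (ℝ × ℝ) := tsupport φ ∩ {q | φ q ≤ 1 / 4} with hK
  have hKc : IsCompact K := h.isCompact_tsupport_φ_inter_le (1 / 4)
  have hKU : K ⊆ U := fun q hq => h.tsupport_φ hq.1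
  have hΩ := isOpen_setOf_radicand_pos h.f_smooth.continuous h.φ_smooth.continuous
  have hP := contDiffOn_sqrt_sq_sub_family h.f_smooth h.φ_smooth
  have hK0 : ∀ q ∈ K, q.1 ≠ 0 := fun q hq => (h.subset_halfPlane (hKU hq)).ne'
  have hKΩ : ∀ q ∈ K, ((0 : ℝ), q) ∈ {p : ℝ × (ℝ × ℝ) | 0 < f p.2 ^ 2 - p.1 * φ p.2} := by
    intro q hq
    simp only [mem_setOf_eq, zero_mul, sub_zero]
    exact pow_pos (h.f_pos (hKU hq)) 2
  have hc : ∀ q ∈ K, c₀ ≤ opL ((fun (ε : ℝ) (q : ℝ × ℝ) => Real.sqrt (f q ^ 2 - ε * φ q)) 0) q := by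
    intro q hq
    have e : (fun q : ℝ × ℝ => Real.sqrt (f q ^ 2 - 0 * φ q)) = f := by
      funext q'; rw [zero_mul, sub_zero, Real.sqrt_sq (h.f_nonneg q')]
    simp only [e]
    exact hL q hq.1 hq.2
  obtain ⟨ρ, hρ, hgt⟩ := exists_forall_opL_gt_of_compact hP hΩ hKc hK0 hKΩ hc₀ hc
  refine ⟨c₀ / 2, by positivity, ρ / (2 * (T + 2)), by positivity, fun δ hδ t ht q hq hφ => ?_⟩
  have hε : ‖2 * t * δ‖ < ρ := by
    rw [Real.norm_eq_abs, abs_mul, abs_mul, abs_of_nonneg hδ.1, abs_two]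
    have ht' : |t| ≤ T + 1 := abs_le.2 ⟨by linarith [ht.1], ht.2⟩
    calc 2 * |t| * δ ≤ 2 * (T + 1) * (ρ / (2 * (T + 2))) := by
          apply mul_le_mul (by linarith) hδ.2 hδ.1 (by positivity)
      _ < ρ := by
          rw [mul_div_assoc']
          rw [div_lt_iff₀ (by positivity)]
          nlinarith
  have := hgt (2 * t * δ) hε q ⟨hq, hφ⟩
  rwa [dampedProfile_eq_sqrt]

/-! ### The structure criterion for perturbed profiles -/

/-- **Perturbed profiles give structures ((4.15), (4.20), in the generality of §4.1).** For a
structure `(v,f,φ)` on `U` and `T > 0` there are `δ₀ > 0` and a cut-off `ψ ∈ C_c^∞(U;[0,1])`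
with `ψ = 1` on `{φ ≥ 1/4}` such that: for every `δ ∈ [0,δ₀]`, `t ∈ [-1,T+1]`, every smooth
`g ≥ 0` which equals the damped profile `√(f² - 2tδφ)` on `{φ < 1}` and satisfies `g > |v|` on
`{φ = 1}`, and every `|b| ≤ 1`, the triple `(bv, g, ψ)` is a structure on `U`; moreover
`Lg ≥ 0` on `{φ < 1/4}` (indeed `> 0` on `supp φ ∩ {φ ≤ 1/4}`), `g > 0` on `U`, `g = 0` off `Ū`,
`g = f` off `supp φ`. Applies to `g = h_{1,t}` (= the damped profile), to `g = h_{2,t}` ((4.14))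
and to `g = qᵏ_{i,t}` ((4.16)), all equal to `√(fᵢ² - 2tδφᵢ)` on `{φᵢ < 1}` because `vᵢ = 0`
there; generalises `exists_isNSIStructure_dampedProfile` (damped profile only, `t ∈ [0,T]`).
[cite: Ozanski2017NSISingular, §4 (4.15) and (4.20)] [cite: Scheffer1985, Lemma 3.2 (3.34)–(3.41)] -/
theorem exists_perturbed_structure (h : IsNSIStructure U v f φ) {T : ℝ} (hT : 0 < T) :
    ∃ δ₀ > 0, ∃ ψ : ℝ × ℝ → ℝ, (∀ q, 1 / 4 ≤ φ q → ψ q = 1) ∧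
      ∀ δ ∈ Icc (0 : ℝ) δ₀, ∀ t ∈ Icc (-1 : ℝ) (T + 1), ∀ g : ℝ × ℝ → ℝ, ContDiff ℝ ∞ g →
        (∀ q, 0 ≤ g q) → (∀ q, φ q < 1 → g q = dampedProfile f φ δ t q) →
        (∀ q, φ q = 1 → (v q).1 ^ 2 + (v q).2 ^ 2 < g q ^ 2) →
        (∀ b : ℝ, |b| ≤ 1 → IsNSIStructure U (b • v) g ψ) ∧
          (∀ q, φ q < 1 / 4 → 0 ≤ opL g q) ∧
          (∀ q ∈ tsupport φ, φ q ≤ 1 / 4 → 0 < opL g q) ∧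
          (∀ q ∈ U, 0 < g q) ∧ (∀ q ∉ closure U, g q = 0) ∧
          (∀ q ∉ tsupport φ, g q = f q) := by
  obtain ⟨m, hm, δ₁, hδ₁, hgap⟩ := h.exists_dampedProfile_gap hT
  obtain ⟨c, hc, δ₂, hδ₂, hLpos⟩ := h.exists_opL_dampedProfile_gt hT
  obtain ⟨hψs, hψm, hψ1, hψ0⟩ := h.steepCutoff_props (θ := 1 / 4) (by norm_num)
  set ψ : ℝ × ℝ → ℝ := fun q => Real.smoothTransition (2 * φ q / (1 / 4) - 1) with hψ
  have hψU : tsupport ψ ⊆ U := by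
    refine (closure_mono fun q hq => ?_).trans h.tsupport_φ
    rw [mem_support] at hq ⊢
    intro h0
    exact hq (hψ0 q (by rw [h0]; norm_num))
  refine ⟨min δ₁ δ₂, lt_min hδ₁ hδ₂, ψ, fun q hq => hψ1 q hq, ?_⟩
  intro δ hδ t ht g hg hg0 hg1 hgv
  have hδ₁' : δ ∈ Icc (0 : ℝ) δ₁ := ⟨hδ.1, hδ.2.trans (min_le_left _ _)⟩
  have hδ₂' : δ ∈ Icc (0 : ℝ) δ₂ := ⟨hδ.1, hδ.2.trans (min_le_right _ _)⟩
  have hgap' := hgap δ hδ₁' t ht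
  -- germs
  have hO1 : IsOpen {q : ℝ × ℝ | φ q < 1} := isOpen_lt h.φ_smooth.continuous continuous_const
  have E1 : ∀ q, φ q < 1 → g =ᶠ[𝓝 q] dampedProfile f φ δ t := fun q hq =>
    Filter.eventually_of_mem (hO1.mem_nhds hq) fun q' hq' => hg1 q' hq'
  have E2 : ∀ q ∉ tsupport φ, dampedProfile f φ δ t =ᶠ[𝓝 q] f := fun q hq =>
    Filter.eventually_of_mem ((isClosed_tsupport φ).isOpen_compl.mem_nhds hq) fun q' hq' =>
      h.dampedProfile_eq_of_notMem δ t hq'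
  have E3 : ∀ q ∉ closure U, f =ᶠ[𝓝 q] fun _ => (0 : ℝ) := fun q hq =>
    Filter.eventually_of_mem (isClosed_closure.isOpen_compl.mem_nhds hq) fun q' hq' =>
      h.f_eq_zero hq'
  -- values
  have hpos : ∀ q ∈ U, 0 < g q := by
    intro q hq
    rcases (h.φ_mem q).2.lt_or_eq with hφ | hφ
    · rw [hg1 q hφ, dampedProfile_apply]
      exact Real.sqrt_pos.2 (h.radicand_pos_of_gap hm hgap' hq)
    · have := hgv q hφ
      rcases (hg0 q).lt_or_eq with h1 | h1
      · exact h1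
      · rw [← h1] at this
        nlinarith [sq_nonneg (v q).1, sq_nonneg (v q).2]
  have hzero : ∀ q ∉ closure U, g q = 0 := by
    intro q hq
    have hqU : q ∉ U := fun h' => hq (subset_closure h')
    have hφ0 : φ q = 0 := image_eq_zero_of_notMem_tsupport fun h' => hqU (h.tsupport_φ h')
    rw [hg1 q (by rw [hφ0]; norm_num), h.dampedProfile_eq_zero δ t hq]
  have hgf : ∀ q ∉ tsupport φ, g q = f q := by
    intro q hq
    have hφ0 : φ q = 0 := image_eq_zero_of_notMem_tsupport hq
    rw [hg1 q (by rw [hφ0]; norm_num), h.dampedProfile_eq_of_notMem δ t hq]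
  -- `L`
  have hLg : ∀ q, φ q < 1 → opL g q = opL (dampedProfile f φ δ t) q := fun q hq =>
    opL_congr_of_eventuallyEq (E1 q hq)
  have hLpos' : ∀ q ∈ tsupport φ, φ q ≤ 1 / 4 → 0 < opL g q := by
    intro q hq hφ
    rw [hLg q (by linarith)]
    exact hc.trans (hLpos δ hδ₂' t ht q hq hφ)
  have hLU : ∀ q ∈ U, φ q < 1 / 4 → 0 < opL g q := by
    intro q hq hφ
    by_cases hφs : q ∈ tsupport φ
    · exact hLpos' q hφs hφ.le
    · rw [hLg q (by linarith), opL_congr_of_eventuallyEq (E2 q hφs)]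
      exact h.opL_pos q hq (by rw [image_eq_zero_of_notMem_tsupport hφs]; norm_num)
  have hLnn : ∀ q, φ q < 1 / 4 → 0 ≤ opL g q := by
    intro q hφ
    by_cases hφs : q ∈ tsupport φ
    · exact (hLpos' q hφs hφ.le).le
    · rw [hLg q (by linarith), opL_congr_of_eventuallyEq (E2 q hφs)]
      by_cases hqc : q ∈ closure U
      · exact h.opL_nonneg_of_mem_closure hqc (by linarith)
      · rw [opL_congr_of_eventuallyEq (E3 q hqc), opL_zero]
  refine ⟨fun b hb => ?_, hLnn, hLpos', hpos, hzero, hgf⟩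
  -- the structure `(bv, g, ψ)`
  have hsm := h.smul hb
  exact
    { isOpen := h.isOpen
      isCompact_closure := h.isCompact_closure
      closure_subset := h.closure_subset
      v_smooth := hsm.v_smooth
      f_smooth := hg
      φ_smooth := hψs
      f_nonneg := hg0
      φ_mem := hψm
      tsupport_f := by
        apply Subset.antisymm
        · exact closure_minimal (fun q hq => by_contra fun h' => hq (hzero q h')) isClosed_closure
        · exact closure_mono fun q hq => mem_support.2 (hpos q hq).ne'
      tsupport_φ := hψU
      tsupport_v := fun q hq => hψ1 q (by
        have h1 : φ q = 1 := hsm.tsupport_v hq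
        rw [h1]; norm_num)
      div_eq_zero := hsm.div_eq_zero
      sq_lt := fun q hq => by
        rcases (h.φ_mem q).2.lt_or_eq with hφ | hφ
        · have hv0 : v q = 0 := h.v_eq_zero_of_lt hφ
          have : (b • v) q = 0 := by simp [hv0]
          rw [this]
          simpa using pow_pos (hpos q hq) 2
        · exact (smul_sq_le hb (v q)).trans_lt (hgv q hφ)
      opL_pos := fun q hq hψq => by
        have hφ : φ q < 1 / 4 := by
          by_contra h'
          exact hψq (hψ1 q (not_lt.1 h'))
        exact hLU q hq hφ }

end IsNSIStructure

end Literature.Barriers.NavierStokesRegularity
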